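import Summits.QuantumAdvantage.QuantumAdvantage.Theorems.SparsityDialRungA

/-! # SparsityDialRungB — part 2/3 (mechanical split for landing of `SparsityDialRung`; content verbatim; scopes re-opened with their variables) -/

set_option linter.dupNamespace false
set_option linter.unusedVariables false
noncomputable section
open scoped Classical

namespace Summit.QuantumAdvantage.QuantumAdvantage.Theorems.SparsityDial
open Finset
open Literature.Computability.QuantumComplexity Literature.Computability.QuantumComplexity.RingHLF
open Literature.Computability.MetaComplexity Literature.Computability.MetaComplexity.Smolensky
open Summit.QuantumAdvantage.AdviceFreeQNC0
open Summit.QuantumAdvantage.QuantumAdvantage.Theses (ExactnessDial.PolyLossOddU3 ExactnessDial.DPLift3)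
open Summit.QuantumAdvantage.QuantumAdvantage.Theorems.HolonomyDial (selP selP_mem selP_apply xorP xorP_mem
  xorP_apply_bool tPoly tPoly_mem tPoly_apply closes_T)
open Summit.QuantumAdvantage.QuantumAdvantage.Theorems.AnchorDial (outB dev loss_shape_mono card_odd_ge flip2 flip2_apply_of_ne
  Frozen OneGap frozen_loss_count)
open Summit.QuantumAdvantage.QuantumAdvantage.Theorems.HolonomyDial (card_odd_le)
open Summit.QuantumAdvantage.QuantumAdvantage.Theorems.LocusDial (Coverable FewLocus FewLocusLossOne3
  coverable_mono_m Coverable.card_le dev_tPoly fewLocusLossOne3_of_fewLocusLoss3)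
open Summit.QuantumAdvantage.QuantumAdvantage.Theorems.StabilizerDial (StabFew pad pad_mem winset_pad deg_pad_stab
  stabFew_of_fewLocus bitP bitP_pad rowMask apIdx apStrat apStrat_mem bitP_apStrat mem_dev_pad_apStrat_iff BlockRec
  fibreIdentityAt_of_block oddSliceBound_holds goodBound_of_blockRec blockSelect_of_fewLocus eventually_polylog
  side_bounds polyLossOddU3_of_stabPos stabGenericLossPos3_of_polyLossOddU3 antipodalGenericPos3)
variable {N : ℕ}

/-! ## §5b  A PROVED D-RUNG.  The LONG block-antipodal family `P♯` (antipodal on `[1, 1+w)`, canonical elsewhere) with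
`w = wBlk n a (c+1) = 8·(log₂ n)^a · kBlk n (c+1)` lies in `D_a`'s class — it has NO cheap `(log₂ n)^a`-point normal
form at level `c+1` (`lbStrat_not_sparse`: E2(c)'s double count with `≤ (log₂ n)^a` exceptional sub-blocks among
`8 (log₂ n)^a`) — and it loses `≥ 1/4` of the odd class by the SAME frozen law (`lbStrat_quarter_loss`; its deviation
set lies in one gap).  Hence `LongBlockLoss3` — `D` restricted to an explicit family INSIDE `D`'s class at the prover's
own scale `a` — is a THEOREM (`longBlockLoss3`), and `D → LongBlockLoss3` BY NAME (`longBlockLoss3_of_dense`).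
HONEST READING: both proved rungs are BLIND fixed-read families confined to one gap; the live content of `S` AND of `D`
is in deviation patterns that read (almost) every adjacent pair / wrap around the cycle (the full antipodal family). -/

/-- the LONG block-antipodal family of width `w`: `t_j ⊕ [x_{j+⌊N/2⌋}]` for `1 ≤ j < 1 + w`, `t_j` otherwise. -/
def lbStrat (w : ℕ) (j : Fin N) : CubeFn (ZMod 3) N :=
  if 1 ≤ j.val ∧ j.val < 1 + w then apStrat j else tPoly j

/-- SparsityDialRungB helper `lbStrat_mem` (decomp-qadv land package; see the module docstring). -/
theorem lbStrat_mem (w : ℕ) (j : Fin N) : lbStrat w j ∈ lowDeg (ZMod 3) N 3 := by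
  unfold lbStrat
  split_ifs
  · exact apStrat_mem j
  · exact lowDeg_mono (by norm_num) (tPoly_mem j)

/-- on the block, position `j` is a deviation of the PADDED long family iff the block recurrence fails at `j`. -/
theorem mem_dev_pad_lbStrat_iff (w : ℕ) (s : Fin N → CubeFn (ZMod 3) N) (x : Fin N → Bool) (j : Fin N)
    (hj : 1 ≤ j.val ∧ j.val < 1 + w) :
    j ∈ dev (pad (fun i : Fin N => lbStrat w i) s) x ↔ rowMask s x j ≠ x (apIdx j) := by
  rw [← mem_dev_pad_apStrat_iff s x j]
  have hb : lbStrat w j = apStrat j := by unfold lbStrat; rw [if_pos hj]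
  have hp : pad (fun i : Fin N => lbStrat w i) s j = pad (fun i : Fin N => apStrat i) s j := by
    simp only [pad, hb]
  simp only [dev, mem_filter, mem_univ, true_and, hp]

/-- membership in the deviation set of the (unpadded) long block-antipodal family. -/
theorem mem_dev_lbStrat_iff (w : ℕ) (y : Fin N → Bool) (j : Fin N) :
    j ∈ dev (fun i : Fin N => lbStrat w i) y ↔ (1 ≤ j.val ∧ j.val < 1 + w) ∧ y (apIdx j) = true := by
  unfold Summit.QuantumAdvantage.QuantumAdvantage.Theorems.AnchorDial.dev
  rw [mem_filter]
  show (j ∈ (univ : Finset (Fin N)) ∧ decide (lbStrat w j y = 1) ≠ tGuess y j) ↔ _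
  simp only [mem_univ, true_and]
  by_cases hj : 1 ≤ j.val ∧ j.val < 1 + w
  · have hb : lbStrat w j = apStrat j := by unfold lbStrat; rw [if_pos hj]
    have hd : decide (lbStrat w j y = 1) = xor (tGuess y j) (y (apIdx j)) := by
      rw [hb]; exact bitP_apStrat j y
    rw [hd]
    simp only [hj, true_and]
    generalize tGuess y j = t; generalize y (apIdx j) = q
    cases t <;> cases q <;> decide
  · have hb : lbStrat w j = tPoly j := by unfold lbStrat; rw [if_neg hj]
    have ht : decide (lbStrat w j y = 1) = tGuess y j := by
      rw [hb, tPoly_apply]; generalize tGuess y j = t; cases t <;> decide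
    rw [ht]
    simp only [hj, false_and, iff_false, ne_eq, not_not]

/-- the long family's deviation set is FROZEN under an adjacent pair-flip past the block and before the antipodes. -/
theorem dev_lbStrat_flip2 (w : ℕ) (hN : w + 8 ≤ N / 2) (y : Fin N → Bool) {a : ℕ} (ha1 : w + 1 ≤ a)
    (ha2 : a + 2 ≤ N / 2) :
    dev (fun i : Fin N => lbStrat w i) (flip2 a (a + 1) y) = dev (fun i : Fin N => lbStrat w i) y := by
  ext j
  rw [mem_dev_lbStrat_iff, mem_dev_lbStrat_iff]
  constructor
  · rintro ⟨hj, hy⟩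
    have hv : (apIdx j).val = j.val + N / 2 := by
      show (j.val + N / 2) % N = _; exact Nat.mod_eq_of_lt (by omega)
    rw [flip2_apply_of_ne y (by omega) (by omega)] at hy
    exact ⟨hj, hy⟩
  · rintro ⟨hj, hy⟩
    have hv : (apIdx j).val = j.val + N / 2 := by
      show (j.val + N / 2) % N = _; exact Nat.mod_eq_of_lt (by omega)
    refine ⟨hj, ?_⟩
    rw [flip2_apply_of_ne y (by omega) (by omega)]
    exact hy

/-- **quarter loss of the long block-antipodal family** (frozen law at sites `w+1`, `w+3`). -/
theorem lbStrat_quarter_loss (w : ℕ) (hN : w + 8 ≤ N / 2) :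
    (univ.filter fun x : Fin N → Bool => OddZeros x).card ≤
      4 * (univ.filter fun x : Fin N → Bool =>
        OddZeros x ∧ ¬ Rel x (outB (fun i : Fin N => lbStrat w i) x)).card := by
  set P : Fin N → CubeFn (ZMod 3) N := fun i => lbStrat w i with hP
  have hN3 : 3 ≤ N := by omega
  have hfro : ∀ x : Fin N → Bool, Frozen P (w + 1) (w + 3) x := by
    intro x
    refine ⟨dev_lbStrat_flip2 w hN x (by omega) (by omega), dev_lbStrat_flip2 w hN x (by omega) (by omega), ?_⟩
    rw [dev_lbStrat_flip2 w hN _ (a := w + 1) (by omega) (by omega),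
      dev_lbStrat_flip2 w hN x (a := w + 3) (by omega) (by omega)]
  have hgap : ∀ x : Fin N → Bool, OneGap P (w + 1) (w + 3) x := fun x =>
    Or.inl fun i hi => by have := ((mem_dev_lbStrat_iff w x i).1 hi).1; omega
  have h := frozen_loss_count hN3 (a₁ := w + 1) (a₂ := w + 3) (by omega) (by omega) P
  have heq : (univ.filter fun x : Fin N → Bool => OddZeros x) =
      (univ.filter fun x : Fin N → Bool =>
        OddZeros x ∧ Frozen P (w + 1) (w + 3) x ∧ OneGap P (w + 1) (w + 3) x) := by
    ext x
    simp only [mem_filter, mem_univ, true_and]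
    exact ⟨fun hx => ⟨hx, hfro x, hgap x⟩, fun hx => hx.1⟩
  rw [heq]
  exact h

/-- **CLASS MEMBERSHIP (core, explicit hypotheses)**: with `8m` sub-blocks of length `k ≥ kBlk`-size, the long
family has no cheap `m`-point normal form at level `e`: an `m`-point-coverable deviation set meets `≤ m` sub-blocks,
so a.e. input satisfies the block recurrence on `≥ 7m` of the `8m` sub-blocks, against `goodBound` (`≤ 3/8`) per block. -/
theorem lbStrat_not_sparse_core (n e m k : ℕ) (hk3 : 3 ≤ k)
    (hkk : 3456 * (8 * (Nat.log 2 n) ^ e + 1) ^ 2 ≤ k) (hL : 16 ≤ Nat.log 2 n) (hm1 : 1 ≤ m)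
    (hw : 8 * m * k + 2 ≤ n / 2) :
    ¬ StabFew m 0 e (fun j : Fin n => lbStrat (8 * m * k) j) := by
  rintro ⟨s, hs, hF⟩
  have ha1 : ∀ i : ℕ, 1 ≤ 1 + i * k := fun i => Nat.le_add_right _ _
  have hik : ∀ i < 8 * m, i * k + k ≤ 8 * m * k := by
    intro i hi
    have h := Nat.mul_le_mul_right k (Nat.succ_le_of_lt hi)
    rw [Nat.succ_mul] at h
    exact h
  have hak : ∀ i < 8 * m, 1 + i * k + k + 1 ≤ n / 2 := by
    intro i hi
    have := hik i hi
    omega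
  have hGB : ∀ i < 8 * m, 8 * (univ.filter fun x : Fin n → Bool =>
      OddZeros x ∧ BlockRec s (1 + i * k) k x).card ≤ 3 * 2 ^ n :=
    fun i hi => goodBound_of_blockRec n e (1 + i * k) k s hs hkk (ha1 i) (hak i hi)
      (fibreIdentityAt_of_block n (1 + i * k) k hk3 (ha1 i) (hak i hi)) (oddSliceBound_holds n)
  set w := 8 * m * k with hwdef
  set Q := 2 ^ (n - 1) with hQdef
  set Good := (univ.filter fun x : Fin n → Bool =>
    OddZeros x ∧ Coverable m 0 (dev (pad (fun j : Fin n => lbStrat w j) s) x)) with hGooddef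
  set Bad := (univ.filter fun x : Fin n → Bool =>
    OddZeros x ∧ ¬ Coverable m 0 (dev (pad (fun j : Fin n => lbStrat w j) s) x)).card with hBaddef
  have hBad : Nat.log 2 n * Bad ≤ Q := hF
  have hBad16 : 16 * Bad ≤ Q := le_trans (Nat.mul_le_mul_right _ hL) hBad
  have hn3 : 3 ≤ n := by
    have : w + 2 ≤ n := le_trans hw (Nat.div_le_self _ _)
    omega
  have hOdd : Q ≤ Good.card + Bad := by
    calc Q ≤ (univ.filter fun x : Fin n → Bool => OddZeros x).card := card_odd_ge (by omega)
      _ ≤ Good.card + Bad := by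
        rw [hGooddef, hBaddef, ← Finset.card_union_of_disjoint]
        · refine card_le_card fun x hx => ?_
          rw [mem_filter] at hx
          rw [mem_union, mem_filter, mem_filter]
          by_cases hB : Coverable m 0 (dev (pad (fun j : Fin n => lbStrat w j) s) x)
          · exact Or.inl ⟨hx.1, hx.2, hB⟩
          · exact Or.inr ⟨hx.1, hx.2, hB⟩
        · rw [Finset.disjoint_left]
          intro x h1 h2
          rw [mem_filter] at h1 h2
          exact h2.2.2 h1.2.2
  -- KEY: a good input violates the block recurrence on AT MOST `m` sub-blocks (violated blocks ↪ deviations)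
  have hexc : ∀ x ∈ Good, ((range (8 * m)).filter fun i => ¬ BlockRec s (1 + i * k) k x).card ≤ m := by
    intro x hx
    rw [hGooddef, mem_filter] at hx
    have hcard : (dev (pad (fun j : Fin n => lbStrat w j) s) x).card ≤ m := card_le_of_coverable_zero hx.2.2
    refine le_trans ?_ hcard
    refine le_trans ?_ (Finset.card_image_le (f := fun j : Fin n => (j.val - 1) / k)
      (s := dev (pad (fun j : Fin n => lbStrat w j) s) x))
    refine card_le_card fun i hi => ?_
    rw [mem_filter, mem_range] at hi
    obtain ⟨hi, hB⟩ := hi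
    have hB' : ∃ j : Fin n, 1 + i * k ≤ j.val ∧ j.val < 1 + i * k + k ∧ rowMask s x j ≠ x (apIdx j) := by
      by_contra hcon
      push Not at hcon
      exact hB fun j hj1 hj2 => hcon j hj1 hj2
    obtain ⟨j, hj1, hj2, hj3⟩ := hB'
    have hikk := hik i hi
    have hblk : 1 ≤ j.val ∧ j.val < 1 + w := ⟨le_trans (ha1 i) hj1, by omega⟩
    have hmem : j ∈ dev (pad (fun i : Fin n => lbStrat w i) s) x := (mem_dev_pad_lbStrat_iff w s x j hblk).mpr hj3
    rw [mem_image]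
    refine ⟨j, hmem, ?_⟩
    show (j.val - 1) / k = i
    refine Nat.div_eq_of_lt_le (by omega) ?_
    rw [Nat.add_mul, one_mul]
    omega
  -- swap the double count: Σ_i #(Good ∩ violatedᵢ) = Σ_{x ∈ Good} #violated(x) ≤ m · #Good
  have hswap : ∑ i ∈ range (8 * m), (Good.filter fun x => ¬ BlockRec s (1 + i * k) k x).card
      = ∑ x ∈ Good, ((range (8 * m)).filter fun i => ¬ BlockRec s (1 + i * k) k x).card := by
    simp only [Finset.card_filter]
    exact Finset.sum_comm
  have hUnion : ∑ i ∈ range (8 * m), (Good.filter fun x => ¬ BlockRec s (1 + i * k) k x).card ≤ m * Good.card := by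
    rw [hswap]
    calc ∑ x ∈ Good, ((range (8 * m)).filter fun i => ¬ BlockRec s (1 + i * k) k x).card
        ≤ ∑ x ∈ Good, m := sum_le_sum fun x hx => hexc x hx
      _ = m * Good.card := by rw [sum_const, smul_eq_mul, mul_comm]
  have hcover : ∀ i : ℕ, Good.card ≤ (univ.filter fun x : Fin n → Bool => OddZeros x ∧ BlockRec s (1 + i * k) k x).card
      + (Good.filter fun x => ¬ BlockRec s (1 + i * k) k x).card := by
    intro i
    refine le_trans (card_le_card fun x hx => ?_) (card_union_le _ _)
    rw [mem_union, mem_filter, mem_filter]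
    by_cases hB : BlockRec s (1 + i * k) k x
    · have hx' := hx
      rw [hGooddef, mem_filter] at hx'
      exact Or.inl ⟨mem_univ _, hx'.2.1, hB⟩
    · exact Or.inr ⟨hx, hB⟩
  set Sg := ∑ i ∈ range (8 * m), (univ.filter fun x : Fin n → Bool => OddZeros x ∧ BlockRec s (1 + i * k) k x).card
    with hSgdef
  have hsum : 8 * m * Good.card ≤ Sg + m * Good.card := by
    calc 8 * m * Good.card = ∑ i ∈ range (8 * m), Good.card := by rw [sum_const, card_range, smul_eq_mul]
      _ ≤ ∑ i ∈ range (8 * m), ((univ.filter fun x : Fin n → Bool => OddZeros x ∧ BlockRec s (1 + i * k) k x).card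
            + (Good.filter fun x => ¬ BlockRec s (1 + i * k) k x).card) := sum_le_sum fun i _ => hcover i
      _ = Sg + ∑ i ∈ range (8 * m), (Good.filter fun x => ¬ BlockRec s (1 + i * k) k x).card := by
            rw [hSgdef, sum_add_distrib]
      _ ≤ Sg + m * Good.card := Nat.add_le_add_left hUnion _
  have hSg : 8 * Sg ≤ 8 * m * (3 * 2 ^ n) := by
    calc 8 * Sg = ∑ i ∈ range (8 * m), 8 * (univ.filter fun x : Fin n → Bool =>
          OddZeros x ∧ BlockRec s (1 + i * k) k x).card := by rw [hSgdef, mul_sum]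
      _ ≤ ∑ i ∈ range (8 * m), 3 * 2 ^ n := sum_le_sum fun i hi => hGB i (mem_range.mp hi)
      _ = 8 * m * (3 * 2 ^ n) := by rw [sum_const, card_range, smul_eq_mul]
  have h2n : 2 ^ n = Q * 2 := by
    rw [hQdef, ← pow_succ]
    congr 1
    omega
  rw [h2n] at hSg
  have h7 : 7 * Good.card ≤ 6 * Q := by
    have h1 : m * (56 * Good.card) ≤ m * (48 * Q) := by nlinarith [hsum, hSg]
    have hm0 : 0 < m := lt_of_lt_of_le Nat.zero_lt_one hm1
    have h56 : 56 * Good.card ≤ 48 * Q := Nat.le_of_mul_le_mul_left h1 hm0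
    omega
  have hQ : 0 < Q := Nat.two_pow_pos _
  omega

/-- the width at sparsity scale `a`, gauge level `e`: `8·(log₂ N)^a` sub-blocks of length `kBlk N e` (polylog). -/
def wBlk (N a e : ℕ) : ℕ := 8 * (Nat.log 2 N) ^ a * kBlk N e

/-- **CLASS MEMBERSHIP**: eventually the long family at width `wBlk n a e` has NO cheap `(log₂ n)^a`-point normal
form at gauge level `e` — it lies in `D_a`'s class (and, literally `wBlk`-point-sparse, in `S_{a'}`'s side for larger `a'`). -/
theorem lbStrat_not_sparse (a e : ℕ) : ∃ n₀ : ℕ, ∀ n ≥ n₀,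
    ¬ StabFew ((Nat.log 2 n) ^ a) 0 e (fun j : Fin n => lbStrat (wBlk n a e) j) := by
  obtain ⟨n₀, hn₀⟩ := eventually_polylog (8 * 279936 + 2) (a + 2 * e)
  refine ⟨n₀, fun n hn => ?_⟩
  obtain ⟨hKn, hL⟩ := hn₀ n hn
  have hL1 : 1 ≤ Nat.log 2 n := le_trans (by norm_num) hL
  have hk_le : kBlk n e ≤ 279936 * Nat.log 2 n ^ (2 * e) := kBlk_le e hL1
  have hm1 : 1 ≤ Nat.log 2 n ^ a := Nat.one_le_pow _ _ hL1
  have hmk : Nat.log 2 n ^ a * kBlk n e ≤ 279936 * Nat.log 2 n ^ (a + 2 * e) := by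
    calc Nat.log 2 n ^ a * kBlk n e ≤ Nat.log 2 n ^ a * (279936 * Nat.log 2 n ^ (2 * e)) :=
          Nat.mul_le_mul_left _ hk_le
      _ = 279936 * Nat.log 2 n ^ (a + 2 * e) := by rw [pow_add]; ring
  have hP : 1 ≤ Nat.log 2 n ^ (a + 2 * e) := Nat.one_le_pow _ _ hL1
  have hw : 8 * Nat.log 2 n ^ a * kBlk n e + 2 ≤ n / 2 := by nlinarith [hmk, hP, hKn]
  exact lbStrat_not_sparse_core n e (Nat.log 2 n ^ a) (kBlk n e) (three_le_kBlk n e) (le_of_eq rfl) hL hm1 hw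

/-- **D-rung (typed)**: at SOME sparsity scale `a` (the prover's), the long block-antipodal family at every gauge
level `c+1 ≥ 2` — a member of `D_a`'s class — is NOT near-perfect. -/
def LongBlockLoss3 : Prop :=
  ∃ a C : ℕ, ∀ c : ℕ, 1 ≤ c → ∃ n₀ : ℕ, ∀ n ≥ n₀,
    ((univ.filter fun x : Fin n → Bool =>
        OddZeros x ∧ Rel x (fun i => decide (lbStrat (wBlk n a (c + 1)) i x = 1))).card : ℝ) ≤
      (1 - 1 / (n : ℝ) ^ C) * (2 : ℝ) ^ (n - 1)

/-- `D → LongBlockLoss3` BY NAME (class membership `lbStrat_not_sparse`; degree `3 ≤ (log₂ n)^c` for `c ≥ 1`). -/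
theorem longBlockLoss3_of_dense (h : DenseGenericLoss3) : LongBlockLoss3 := by
  obtain ⟨a, C, hC⟩ := h
  refine ⟨a, C, fun c hc => ?_⟩
  obtain ⟨n₁, hn₁⟩ := hC c
  obtain ⟨n₃, hn₃⟩ := lbStrat_not_sparse a (c + 1)
  refine ⟨max (max n₁ n₃) 8, fun n hn => ?_⟩
  have hn1 : n₁ ≤ n := le_trans (le_trans (le_max_left _ _) (le_max_left _ _)) hn
  have hn3 : n₃ ≤ n := le_trans (le_trans (le_max_right _ _) (le_max_left _ _)) hn
  have h8 : 2 ^ 3 ≤ n := le_trans (le_max_right _ _) hn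
  have hL : 3 ≤ Nat.log 2 n := Nat.le_log_of_pow_le (by norm_num) h8
  have h3 : 3 ≤ (Nat.log 2 n) ^ c := by
    calc 3 ≤ Nat.log 2 n := hL
      _ = Nat.log 2 n ^ 1 := (pow_one _).symm
      _ ≤ Nat.log 2 n ^ c := Nat.pow_le_pow_right (by omega) hc
  have hdeg : ∀ i : Fin n, lbStrat (wBlk n a (c + 1)) i ∈ lowDeg (ZMod 3) n ((Nat.log 2 n) ^ c) := fun i =>
    lowDeg_mono h3 (lbStrat_mem _ i)
  exact hn₁ n hn1 _ hdeg (hn₃ n hn3)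

/-- from the combinatorial quarter-loss to the real-valued loss form with `C = 1` (`n ≥ 8`). -/
theorem real_loss_of_quarter {n : ℕ} (h8 : 8 ≤ n) (P : Fin n → CubeFn (ZMod 3) n)
    (hq : (univ.filter fun x : Fin n → Bool => OddZeros x).card ≤
      4 * (univ.filter fun x : Fin n → Bool => OddZeros x ∧ ¬ Rel x (outB P x)).card) :
    ((univ.filter fun x : Fin n → Bool => OddZeros x ∧ Rel x (fun i => decide (P i x = 1))).card : ℝ) ≤
      (1 - 1 / (n : ℝ) ^ 1) * (2 : ℝ) ^ (n - 1) := by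
  set W := (univ.filter fun x : Fin n → Bool =>
    OddZeros x ∧ Rel x (fun i => decide (P i x = 1))).card with hW
  set Lo := (univ.filter fun x : Fin n → Bool =>
    OddZeros x ∧ ¬ Rel x (fun i => decide (P i x = 1))).card with hLo
  set O := (univ.filter fun x : Fin n → Bool => OddZeros x).card with hO
  have hq' : O ≤ 4 * Lo := hq
  have hsplit : W + Lo = O := by
    have hs := Finset.card_filter_add_card_filter_not
      (s := univ.filter fun x : Fin n → Bool => OddZeros x)
      (fun x : Fin n → Bool => Rel x (fun i => decide (P i x = 1)))
    rw [filter_filter, filter_filter] at hs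
    exact hs
  have hOle : O ≤ 2 ^ (n - 1) := card_odd_le (n := n) (by omega)
  have h4 : 4 * W ≤ 3 * 2 ^ (n - 1) := by omega
  have hW' : (4 : ℝ) * (W : ℝ) ≤ 3 * (2 : ℝ) ^ (n - 1) := by exact_mod_cast h4
  have hpow : (0 : ℝ) < (2 : ℝ) ^ (n - 1) := by positivity
  have hn4 : (4 : ℝ) ≤ (n : ℝ) := by exact_mod_cast (show 4 ≤ n by omega)
  rw [pow_one]
  have hfrac : (3 : ℝ) / 4 ≤ 1 - 1 / (n : ℝ) := by
    rw [div_le_iff₀ (by norm_num : (0 : ℝ) < 4)]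
    have : 1 / (n : ℝ) ≤ 1 / 4 := one_div_le_one_div_of_le (by norm_num) hn4
    nlinarith
  calc (W : ℝ) ≤ 3 / 4 * (2 : ℝ) ^ (n - 1) := by nlinarith
    _ ≤ (1 - 1 / (n : ℝ)) * (2 : ℝ) ^ (n - 1) := by nlinarith

/-- **THE D-RUNG, PROVED** — indeed at EVERY scale `a` and level: the long block-antipodal family loses `≥ 1/4`. -/
theorem longBlockLoss_all (a c : ℕ) : ∃ n₀ : ℕ, ∀ n ≥ n₀,
    ((univ.filter fun x : Fin n → Bool =>
        OddZeros x ∧ Rel x (fun i => decide (lbStrat (wBlk n a (c + 1)) i x = 1))).card : ℝ) ≤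
      (1 - 1 / (n : ℝ) ^ 1) * (2 : ℝ) ^ (n - 1) := by
  obtain ⟨n₀, hn₀⟩ := eventually_polylog (8 * 279936 + 8) (a + 2 * (c + 1))
  refine ⟨max n₀ 8, fun n hn => ?_⟩
  obtain ⟨hK, hL⟩ := hn₀ n (le_of_max_le_left hn)
  have h8 : 8 ≤ n := le_of_max_le_right hn
  have hL1 : 1 ≤ Nat.log 2 n := by omega
  have hk_le : kBlk n (c + 1) ≤ 279936 * Nat.log 2 n ^ (2 * (c + 1)) := kBlk_le (N := n) (c + 1) hL1
  have hmk : Nat.log 2 n ^ a * kBlk n (c + 1) ≤ 279936 * Nat.log 2 n ^ (a + 2 * (c + 1)) := by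
    calc Nat.log 2 n ^ a * kBlk n (c + 1) ≤ Nat.log 2 n ^ a * (279936 * Nat.log 2 n ^ (2 * (c + 1))) :=
          Nat.mul_le_mul_left _ hk_le
      _ = 279936 * Nat.log 2 n ^ (a + 2 * (c + 1)) := by rw [pow_add]; ring
  have hP : 1 ≤ Nat.log 2 n ^ (a + 2 * (c + 1)) := Nat.one_le_pow _ _ hL1
  have hcond : wBlk n a (c + 1) + 8 ≤ n / 2 := by
    show 8 * Nat.log 2 n ^ a * kBlk n (c + 1) + 8 ≤ n / 2
    nlinarith [hmk, hP, hK]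
  exact real_loss_of_quarter h8 _ (lbStrat_quarter_loss (N := n) (wBlk n a (c + 1)) hcond)

/-- SparsityDialRungB helper `longBlockLoss3` (decomp-qadv land package; see the module docstring). -/
theorem longBlockLoss3 : LongBlockLoss3 :=
  ⟨0, 1, fun c _ => longBlockLoss_all 0 c⟩



end Summit.QuantumAdvantage.QuantumAdvantage.Theorems.SparsityDial
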